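import Literature.Topology.FourManifolds.PalaisComplementBallInversion
import Literature.Topology.FourManifolds.CollarUniquenessBall
import Literature.Topology.FourManifolds.InvertedGermExtension
import Literature.Topology.FourManifolds.SmoothEmbeddingCriteria
import Mathlib.Topology.MetricSpace.Thickening
import HarnessLib

/-!
# The complementary ball with a two-sided matching collar

Topic `Literature/Topology/FourManifolds`; second step (after
`PalaisComplementBallInversion.lean`) of the elementary differential topology behind the
exotic-`ℝ⁴` bridge of this seat (Kirby 1989, Ch. XIV, proof of Thm. 3, p. 101; fact file
`HCobordismPartialProduct.lean`).

For a smooth embedding `e : ℝⁿ → S` of Euclidean space into the unit sphere `S` of an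
`(n+1)`-dimensional real inner product space, `PalaisComplementBallInversion.lean` gives a
diffeomorphism `d : ℝⁿ ≃ U ⊆ S` with `d(𝔻ⁿ) = S ∖ e(B̊ⁿ)` and `d = e ∘ ι` OUTSIDE the unit ball
(`ι y = y / ‖y‖²` the inversion). Here the matching is improved to a TWO-SIDED collar of the unit
sphere:

* `exists_complementBall_eq_inversion_nhds` — there are `δ ∈ (0, 1)` and a partial
  diffeomorphism `D` of `ℝⁿ` into `S` defined on all of `ℝⁿ` (an `OpenPartialHomeomorph` with
  source `univ`, `C^∞` with `C^∞` inverse) such that `D(𝔻ⁿ) = S ∖ e(B̊ⁿ)`, `D(B̊ⁿ) = S ∖ e(𝔻ⁿ)` and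
  **`D y = e (y / ‖y‖²)` for all `‖y‖ > 1 - δ`**.

So the closed complement of the open ball `e(B̊ⁿ)` is a smoothly embedded closed ball whose
parametrisation agrees with `e ∘ ι` on a neighbourhood of the boundary sphere on both sides — the
form in which "the complement of a smooth n-ball in `Sⁿ` is always a smooth n-ball" (Kirby 1989,
p. 101) can be glued smoothly to other maps along the seam.

Auxiliary content: `Diffeomorph.toOpenPartialHomeomorphOpens` (a diffeomorphism onto an open
subset `U ⊆ N` as an `OpenPartialHomeomorph M N` with source `univ`, smooth with smooth inverse
on `U`); `sphereInversion.apply_of_norm_eq_one` and `sphereInversion.partialHomeomorph` (two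
additions to the API of the tree's inversion `y ↦ y / ‖y‖²`,
`Literature.Topology.FourManifolds.sphereInversion` of `InvertedGermExtension.lean`, which is
used throughout); `mem_thickening_sphere_of_mem_closedShell`. Throughout, "partial diffeomorphism" means an
`OpenPartialHomeomorph` that is `C^∞` on its source with `C^∞` inverse on its target (the tree's
idiom of `exists_chart_of_isSmoothEmbedding`, `isSmoothEmbedding_of_openPartialHomeomorph`).

## Proof

`θ := d⁻¹ ∘ e ∘ ι` is an inner collar of the unit sphere in the closed unit ball in the sense of
`Literature.Topology.FourManifolds.IsInnerCollar` (`CollarUniquenessBall.lean`): it is `C^∞` on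
a thin closed shell `{1 - ε < ‖x‖ ≤ 1}`, fixes the unit sphere pointwise (there `d = e`), maps the
shell into the ball, and has the `C^∞` left inverse `ι ∘ e⁻¹ ∘ d`. By the uniqueness of collars
in the elementary ambient form proved there
(`IsInnerCollar.exists_openPartialHomeomorph_extend`), `θ` agrees near the sphere with a
diffeomorphism `Θ` of the open unit ball. Then `D := d ∘ Θ` on the open ball and `D := e ∘ ι`
on `{‖y‖ > 1 - δ}` agree on the overlap, and `D` is the required partial diffeomorphism.

## References

* M. W. Hirsch, *Differential Topology*, GTM 33 (1976), Ch. 4 §6 (collars), Ch. 8 Thm. 1.8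
  (uniqueness of collars), Thm. 3.1 (disc theorem). [HirschDT1976]
* R. C. Kirby, *The Topology of 4-Manifolds*, LNM 1374 (1989), Ch. XIV, proof of Thm. 3,
  p. 101. [Kirby1989]
-/

open scoped Manifold ContDiff Topology RealInnerProductSpace
open Function Set Metric Module

noncomputable section

namespace Literature.Topology.FourManifolds


/-! ### Diffeomorphisms onto open subsets as globally defined partial diffeomorphisms -/

section OntoOpens

variable {EM : Type*} [NormedAddCommGroup EM] [NormedSpace ℝ EM] {HM : Type*}
  [TopologicalSpace HM] {I : ModelWithCorners ℝ EM HM}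
  {EN : Type*} [NormedAddCommGroup EN] [NormedSpace ℝ EN] {HN : Type*}
  [TopologicalSpace HN] {J : ModelWithCorners ℝ EN HN}
  {M : Type*} [TopologicalSpace M] [ChartedSpace HM M]
  {N : Type*} [TopologicalSpace N] [ChartedSpace HN N]

/-- A diffeomorphism `d : M ≃ U` onto an open subset `U ⊆ N`, viewed as an open partial
homeomorphism `M → N` with source `univ` and target `U`. [folklore] -/
def Diffeomorph.toOpenPartialHomeomorphOpens [Nonempty M] {U : TopologicalSpace.Opens N}
    (d : M ≃ₘ⟮I, J⟯ U) : OpenPartialHomeomorph M N :=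
  d.toHomeomorph.toOpenPartialHomeomorph.trans
    (U.openPartialHomeomorphSubtypeCoe ⟨d (Classical.arbitrary M)⟩)

variable [Nonempty M] {U : TopologicalSpace.Opens N} (d : M ≃ₘ⟮I, J⟯ U)

/-- The partial homeomorphism of `d` acts as `Subtype.val ∘ d`. [folklore] -/
@[simp]
theorem Diffeomorph.coe_toOpenPartialHomeomorphOpens :
    (Diffeomorph.toOpenPartialHomeomorphOpens d : M → N) = Subtype.val ∘ d := rfl

/-- The partial homeomorphism of `d` is defined everywhere. [folklore] -/
@[simp]
theorem Diffeomorph.toOpenPartialHomeomorphOpens_source :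
    (Diffeomorph.toOpenPartialHomeomorphOpens d).source = univ := by
  simp [Diffeomorph.toOpenPartialHomeomorphOpens]

/-- The partial homeomorphism of `d` has target `U`. [folklore] -/
@[simp]
theorem Diffeomorph.toOpenPartialHomeomorphOpens_target :
    (Diffeomorph.toOpenPartialHomeomorphOpens d).target = (U : Set N) := by
  rw [Diffeomorph.toOpenPartialHomeomorphOpens, OpenPartialHomeomorph.trans_target,
    TopologicalSpace.Opens.openPartialHomeomorphSubtypeCoe_target]
  simp

/-- The inverse of the partial homeomorphism of `d` is `d⁻¹` on `U`. [folklore] -/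
theorem Diffeomorph.toOpenPartialHomeomorphOpens_symm_apply (u : U) :
    (Diffeomorph.toOpenPartialHomeomorphOpens d).symm u = d.symm u := by
  have hu : (u : N) ∈ (Diffeomorph.toOpenPartialHomeomorphOpens d).target := by
    rw [Diffeomorph.toOpenPartialHomeomorphOpens_target]; exact u.2
  have h1 := (Diffeomorph.toOpenPartialHomeomorphOpens d).right_inv hu
  rw [Diffeomorph.coe_toOpenPartialHomeomorphOpens, comp_apply] at h1
  have h2 : d ((Diffeomorph.toOpenPartialHomeomorphOpens d).symm u) = u := Subtype.ext h1
  have h3 := congrArg d.symm h2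
  rwa [Diffeomorph.symm_apply_apply] at h3

/-- The partial homeomorphism of `d` is smooth. [folklore] -/
theorem Diffeomorph.contMDiffOn_toOpenPartialHomeomorphOpens :
    ContMDiffOn I J ∞ (Diffeomorph.toOpenPartialHomeomorphOpens d)
      (Diffeomorph.toOpenPartialHomeomorphOpens d).source := by
  rw [Diffeomorph.toOpenPartialHomeomorphOpens_source, contMDiffOn_univ,
    Diffeomorph.coe_toOpenPartialHomeomorphOpens]
  exact contMDiff_subtype_val.comp d.contMDiff

/-- The inverse of the partial homeomorphism of `d` is smooth on `U`. [folklore] -/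
theorem Diffeomorph.contMDiffOn_toOpenPartialHomeomorphOpens_symm :
    ContMDiffOn J I ∞ (Diffeomorph.toOpenPartialHomeomorphOpens d).symm
      (Diffeomorph.toOpenPartialHomeomorphOpens d).target := by
  intro p hp
  rw [Diffeomorph.toOpenPartialHomeomorphOpens_target] at hp
  have h : ContMDiffAt J I ∞ (fun u : U ↦ (Diffeomorph.toOpenPartialHomeomorphOpens d).symm u)
      ⟨p, hp⟩ := by
    have : (fun u : U ↦ (Diffeomorph.toOpenPartialHomeomorphOpens d).symm u) = d.symm :=
      funext (Diffeomorph.toOpenPartialHomeomorphOpens_symm_apply d)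
    rw [this]; exact d.symm.contMDiff.contMDiffAt
  exact (contMDiffAt_subtype_iff.mp h).contMDiffWithinAt

end OntoOpens

/-! ### Two additions to the API of `sphereInversion` -/

section Inversion

variable {F : Type*} [NormedAddCommGroup F] [InnerProductSpace ℝ F]

/-- The inversion in the unit sphere fixes the unit sphere pointwise. [folklore] -/
theorem sphereInversion.apply_of_norm_eq_one {y : F} (hy : ‖y‖ = 1) : sphereInversion y = y := by
  rw [sphereInversion.apply_def, hy, one_pow, inv_one, one_smul]

/-- The inversion in the unit sphere as an open partial homeomorphism of `F` with source and
target `F ∖ {0}`. [folklore] -/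
def sphereInversion.partialHomeomorph : OpenPartialHomeomorph F F where
  toFun := sphereInversion
  invFun := sphereInversion
  source := {0}ᶜ
  target := {0}ᶜ
  map_source' _ hy := sphereInversion.ne_zero hy
  map_target' _ hy := sphereInversion.ne_zero hy
  left_inv' y _ := sphereInversion.apply_apply y
  right_inv' y _ := sphereInversion.apply_apply y
  open_source := isOpen_compl_singleton
  open_target := isOpen_compl_singleton
  continuousOn_toFun := sphereInversion.continuousOn
  continuousOn_invFun := sphereInversion.continuousOn

/-- The inversion partial homeomorphism acts as the inversion. [folklore] -/
@[simp]
theorem sphereInversion.coe_partialHomeomorph :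
    (sphereInversion.partialHomeomorph : F → F) = sphereInversion := rfl

/-- Its source is `F ∖ {0}`. [folklore] -/
@[simp]
theorem sphereInversion.partialHomeomorph_source :
    (sphereInversion.partialHomeomorph : OpenPartialHomeomorph F F).source = {0}ᶜ := rfl

omit [InnerProductSpace ℝ F] in
/-- A point of the closed shell `{1 - ε < ‖x‖ ≤ 1}`, `ε ≤ 1`, is nonzero. [folklore] -/
theorem ne_zero_of_mem_closedShell {ε : ℝ} (hε : ε ≤ 1) {x : F} (hx : x ∈ (closedShell ε : Set F)) :
    x ≠ 0 := by
  rw [mem_closedShell_iff] at hx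
  rw [← norm_pos_iff]; linarith [hx.1]

/-- A point `x` with `1 - ε < ‖x‖ ≤ 1` is within distance `ε` of the unit sphere (witness
`x / ‖x‖`). [folklore] -/
theorem mem_thickening_sphere_of_mem_closedShell {ε : ℝ} (hε : ε ≤ 1) {x : F}
    (hx : x ∈ (closedShell ε : Set F)) : x ∈ thickening ε (sphere (0 : F) 1) := by
  have hx0 : x ≠ 0 := ne_zero_of_mem_closedShell hε hx
  rw [mem_closedShell_iff] at hx
  have hn : 0 < ‖x‖ := norm_pos_iff.2 hx0
  rw [mem_thickening_iff]
  refine ⟨‖x‖⁻¹ • x, by simp [norm_smul, hn.ne'], ?_⟩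
  rw [dist_eq_norm]
  have : x - ‖x‖⁻¹ • x = (1 - ‖x‖⁻¹) • x := by rw [sub_smul, one_smul]
  rw [this, norm_smul, Real.norm_eq_abs, abs_of_nonpos (by
    rw [sub_nonpos]; exact one_le_inv_iff₀.2 ⟨hn, hx.2⟩)]
  have h1 : -(1 - ‖x‖⁻¹) * ‖x‖ = 1 - ‖x‖ := by field_simp; ring
  rw [h1]; linarith [hx.1]

end Inversion

/-! ### The two-sided complementary ball -/

section TwoSided

variable {V : Type*} [NormedAddCommGroup V] [InnerProductSpace ℝ V] {n : ℕ}
  [Fact (finrank ℝ V = n + 1)]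

/-- **The complementary ball with a two-sided matching collar.** Let `e` be a partial
diffeomorphism of `ℝⁿ` into the unit sphere `S` of an `(n+1)`-dimensional real inner product
space, defined on all of `ℝⁿ` (`C^∞` with `C^∞` inverse on its open range). Then there are
`δ ∈ (0, 1)` and a partial diffeomorphism `D` of `ℝⁿ` into `S`, defined on all of `ℝⁿ`, with
`D(𝔻ⁿ) = S ∖ e(B̊ⁿ)`, `D(B̊ⁿ) = S ∖ e(𝔻ⁿ)`, and `D y = e (y / ‖y‖²)` for ALL `‖y‖ > 1 - δ`: the closed
complement of the open ball `e(B̊ⁿ)` is a smoothly embedded closed ball, parametrised so as to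
agree with `e` turned inside out on a two-sided neighbourhood of the boundary sphere. Palais'
disc theorem (Hirsch 1976, Ch. 8, Thm. 3.1) in ball-complement form with the inverted collar
(`exists_complementBall_eq_inversion`), improved inside the ball by the uniqueness of collars
(`IsInnerCollar.exists_openPartialHomeomorph_extend`, Hirsch Ch. 8, Thm. 1.8). [cite: HirschDT1976, Ch. 8 Thm. 3.1 and Thm. 1.8] -/
theorem exists_complementBall_eq_inversion_nhds
    (e : OpenPartialHomeomorph (EuclideanSpace ℝ (Fin n)) (sphere (0 : V) 1))
    (hsrc : e.source = univ) (he : ContMDiffOn (𝓡 n) (𝓡 n) ∞ e e.source)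
    (he' : ContMDiffOn (𝓡 n) (𝓡 n) ∞ e.symm e.target) :
    ∃ (δ : ℝ) (D : OpenPartialHomeomorph (EuclideanSpace ℝ (Fin n)) (sphere (0 : V) 1)),
      0 < δ ∧ δ < 1 ∧ D.source = univ ∧
      ContMDiffOn (𝓡 n) (𝓡 n) ∞ D D.source ∧ ContMDiffOn (𝓡 n) (𝓡 n) ∞ D.symm D.target ∧
      (∀ y, 1 - δ < ‖y‖ → D y = e ((‖y‖ ^ 2)⁻¹ • y)) ∧
      D '' closedBall 0 1 = (e '' ball 0 1)ᶜ ∧ D '' ball 0 1 = (e '' closedBall 0 1)ᶜ := by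
  -- Step A: `e` is a smooth embedding; Step B: the inverted complementary ball `d`
  have hemb : Manifold.IsSmoothEmbedding (𝓡 n) (𝓡 n) ∞ e :=
    isSmoothEmbedding_of_openPartialHomeomorph e hsrc he he'
      (ContinuousLinearEquiv.refl ℝ (EuclideanSpace ℝ (Fin n)))
  have hec : ContMDiff (𝓡 n) (𝓡 n) ∞ e := by
    rw [← contMDiffOn_univ, ← hsrc]; exact he
  have heinj : Injective e := hemb.isEmbedding.injective
  have hetgt : e.target = range e := by
    rw [← e.image_source_eq_target, hsrc, image_univ]
  obtain ⟨U, d, hcol, hcl, hop⟩ := exists_complementBall_eq_inversion hemb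
  set Dd := Diffeomorph.toOpenPartialHomeomorphOpens d with hDd
  have hDd_coe : ∀ y, Dd y = (d y : sphere (0 : V) 1) := fun _ ↦ rfl
  have hDd_src : Dd.source = univ := Diffeomorph.toOpenPartialHomeomorphOpens_source d
  have hDd_tgt : Dd.target = (U : Set (sphere (0 : V) 1)) :=
    Diffeomorph.toOpenPartialHomeomorphOpens_target d
  have hDd_c : ContMDiff (𝓡 n) (𝓡 n) ∞ Dd := by
    rw [← contMDiffOn_univ, ← hDd_src]
    exact Diffeomorph.contMDiffOn_toOpenPartialHomeomorphOpens d
  have hDd_c' : ContMDiffOn (𝓡 n) (𝓡 n) ∞ Dd.symm (U : Set (sphere (0 : V) 1)) := by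
    rw [← hDd_tgt]; exact Diffeomorph.contMDiffOn_toOpenPartialHomeomorphOpens_symm d
  have hDd_cl : Dd '' closedBall 0 1 = (e '' ball 0 1)ᶜ := hcl
  have hDd_op : Dd '' ball 0 1 = (e '' closedBall 0 1)ᶜ := hop
  have hDd_col : ∀ y : EuclideanSpace ℝ (Fin n), 1 ≤ ‖y‖ → Dd y = e (sphereInversion y) := hcol
  -- the inversion
  set ι : EuclideanSpace ℝ (Fin n) → EuclideanSpace ℝ (Fin n) := sphereInversion with hι
  -- Step C: the collar and its left inverse
  set θ : EuclideanSpace ℝ (Fin n) → EuclideanSpace ℝ (Fin n) := fun x ↦ Dd.symm (e (ι x)) with hθ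
  set θinv : EuclideanSpace ℝ (Fin n) → EuclideanSpace ℝ (Fin n) :=
    fun x ↦ ι (e.symm (Dd x)) with hθinv
  -- Step D: the good open set and the width `ε`
  set O : Set (EuclideanSpace ℝ (Fin n)) :=
    {0}ᶜ ∩ (e ∘ ι) ⁻¹' (U : Set (sphere (0 : V) 1)) ∩
      (Dd ⁻¹' (e.target ∩ e.symm ⁻¹' {0}ᶜ)) with hO
  have hO_open : IsOpen O := by
    refine ((ContinuousOn.isOpen_inter_preimage ?_ isOpen_compl_singleton U.isOpen)).inter ?_
    · exact hec.continuous.comp_continuousOn sphereInversion.continuousOn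
    · exact (e.continuousOn_symm.isOpen_inter_preimage e.open_target
        isOpen_compl_singleton).preimage hDd_c.continuous
  have hsphO : sphere (0 : EuclideanSpace ℝ (Fin n)) 1 ⊆ O := by
    intro x hx
    have hx1 : ‖x‖ = 1 := by simpa using hx
    have hx0 : x ≠ 0 := by rw [← norm_pos_iff, hx1]; exact one_pos
    have hιx : ι x = x := sphereInversion.apply_of_norm_eq_one hx1
    have hex : e x = Dd x := by rw [hDd_col x hx1.ge, hιx]
    refine ⟨⟨hx0, ?_⟩, ?_⟩
    · show e (ι x) ∈ (U : Set (sphere (0 : V) 1))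
      rw [hιx, hex, ← hDd_tgt]; exact Dd.map_source (by rw [hDd_src]; exact mem_univ x)
    · show Dd x ∈ e.target ∩ e.symm ⁻¹' {0}ᶜ
      refine ⟨by rw [← hex]; exact e.map_source (by rw [hsrc]; exact mem_univ x), ?_⟩
      show e.symm (Dd x) ≠ 0
      rw [← hex, e.left_inv (by rw [hsrc]; exact mem_univ x)]; exact hx0
  obtain ⟨ε₀, hε₀, hε₀O⟩ :=
    (isCompact_sphere (0 : EuclideanSpace ℝ (Fin n)) 1).exists_thickening_subset_open hO_open hsphO
  set ε : ℝ := min ε₀ (1 / 2) with hε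
  have hεpos : 0 < ε := lt_min hε₀ (by norm_num)
  have hε1 : ε ≤ 1 := (min_le_right _ _).trans (by norm_num)
  have hshellO : (closedShell ε : Set (EuclideanSpace ℝ (Fin n))) ⊆ O := fun x hx ↦
    hε₀O (thickening_mono (min_le_left _ _) _ (mem_thickening_sphere_of_mem_closedShell hε1 hx))
  -- unpacking membership in `O`
  have hO1 : ∀ x ∈ O, x ≠ 0 := fun x hx ↦ hx.1.1
  have hO2 : ∀ x ∈ O, e (ι x) ∈ (U : Set (sphere (0 : V) 1)) := fun x hx ↦ hx.1.2
  have hO3 : ∀ x ∈ O, Dd x ∈ e.target := fun x hx ↦ hx.2.1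
  have hO4 : ∀ x ∈ O, e.symm (Dd x) ≠ 0 := fun x hx ↦ hx.2.2
  -- Step E: `θ` is an inner collar
  have hι_md : ContMDiffOn (𝓡 n) (𝓡 n) ∞ ι {0}ᶜ := sphereInversion.contDiffOn.contMDiffOn
  have hθ_md : ContMDiffOn (𝓡 n) (𝓡 n) ∞ θ O :=
    hDd_c'.comp ((hec.comp_contMDiffOn hι_md).mono fun x hx ↦ hO1 x hx) fun x hx ↦ hO2 x hx
  have hθinv_md : ContMDiffOn (𝓡 n) (𝓡 n) ∞ θinv O :=
    hι_md.comp ((he'.comp hDd_c.contMDiffOn fun x hx ↦ hx).mono fun x hx ↦ hO3 x hx)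
      fun x hx ↦ hO4 x hx
  have hθ_right : ∀ x ∈ O, Dd (θ x) = e (ι x) := fun x hx ↦
    Dd.right_inv (by rw [hDd_tgt]; exact hO2 x hx)
  have hnormι : ∀ x : EuclideanSpace ℝ (Fin n), ‖ι x‖ = ‖x‖⁻¹ := sphereInversion.norm_apply
  have hθ_mem_closedBall : ∀ x ∈ O, ‖x‖ ≤ 1 → ‖θ x‖ ≤ 1 := by
    intro x hx hx1
    have hx0 : 0 < ‖x‖ := norm_pos_iff.2 (hO1 x hx)
    have hp : e (ι x) ∈ (e '' ball (0 : EuclideanSpace ℝ (Fin n)) 1)ᶜ := by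
      rintro ⟨w, hw, hwp⟩
      have hw' : w = ι x := heinj hwp
      rw [hw', mem_ball_zero_iff, hnormι] at hw
      exact absurd hw (not_lt.2 (one_le_inv_iff₀.2 ⟨hx0, hx1⟩))
    rw [← hDd_cl] at hp
    obtain ⟨z, hz, hzp⟩ := hp
    have : θ x = z := by
      show Dd.symm (e (ι x)) = z
      rw [← hzp, Dd.left_inv (by rw [hDd_src]; exact mem_univ z)]
    rw [this]; exact mem_closedBall_zero_iff.1 hz
  have hθ_mem_ball : ∀ x ∈ O, ‖x‖ < 1 → ‖θ x‖ < 1 := by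
    intro x hx hx1
    have hx0 : 0 < ‖x‖ := norm_pos_iff.2 (hO1 x hx)
    have hp : e (ι x) ∈ (e '' closedBall (0 : EuclideanSpace ℝ (Fin n)) 1)ᶜ := by
      rintro ⟨w, hw, hwp⟩
      have hw' : w = ι x := heinj hwp
      rw [hw', mem_closedBall_zero_iff, hnormι] at hw
      exact absurd hw (not_le.2 ((one_lt_inv_iff₀.2 ⟨hx0, hx1⟩)))
    rw [← hDd_op] at hp
    obtain ⟨z, hz, hzp⟩ := hp
    have : θ x = z := by
      show Dd.symm (e (ι x)) = z
      rw [← hzp, Dd.left_inv (by rw [hDd_src]; exact mem_univ z)]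
    rw [this]; exact mem_ball_zero_iff.1 hz
  have hIC : IsInnerCollar ε θ θinv :=
    { pos := hεpos
      contDiffOn := contMDiffOn_iff_contDiffOn.mp (hθ_md.mono hshellO)
      contDiffOn_symm := contMDiffOn_iff_contDiffOn.mp (hθinv_md.mono hshellO)
      eq_self := fun x hx ↦ by
        have hιx : ι x = x := sphereInversion.apply_of_norm_eq_one hx
        show Dd.symm (e (ι x)) = x
        have hex : e x = Dd x := by rw [hDd_col x hx.ge, hιx]
        rw [hιx, hex, Dd.left_inv (by rw [hDd_src]; exact mem_univ x)]
      norm_le_one := fun x hx ↦ hθ_mem_closedBall x (hshellO hx) (mem_closedShell_iff.1 hx).2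
      norm_lt_one := fun x hx hx1 ↦ hθ_mem_ball x (hshellO hx) hx1
      left_inv := fun x hx _ ↦ by
        have hxO := hshellO hx
        show ι (e.symm (Dd (Dd.symm (e (ι x))))) = x
        rw [Dd.right_inv (by rw [hDd_tgt]; exact hO2 x hxO),
          e.left_inv (by rw [hsrc]; exact mem_univ _), hι, sphereInversion.apply_apply] }
  -- Step F: extend the collar to a diffeomorphism `Θ` of the open unit ball
  obtain ⟨Θ, δ, hδ, hδε, hΘs, hΘt, hΘc, hΘc', hΘeq, -⟩ := hIC.exists_openPartialHomeomorph_extend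
  have hδ1 : δ < 1 := hδε.trans_le hε1
  have hΘ_maps : ∀ y : EuclideanSpace ℝ (Fin n), ‖y‖ < 1 → ‖Θ y‖ < 1 := fun y hy ↦ by
    have := Θ.map_source (x := y) (by rw [hΘs]; exact mem_ball_zero_iff.2 hy)
    rw [hΘt] at this; exact mem_ball_zero_iff.1 this
  have hΘ_md : ContMDiffOn (𝓡 n) (𝓡 n) ∞ Θ (ball 0 1) := hΘc.contMDiffOn
  have hΘ_md' : ContMDiffOn (𝓡 n) (𝓡 n) ∞ Θ.symm (ball 0 1) := hΘc'.contMDiffOn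
  -- Step G: the glued map
  set Df : EuclideanSpace ℝ (Fin n) → sphere (0 : V) 1 :=
    fun y ↦ if ‖y‖ < 1 then Dd (Θ y) else e (ι y) with hDf
  have hDf_in : ∀ y, ‖y‖ < 1 → Df y = Dd (Θ y) := fun y hy ↦ if_pos hy
  have hDf_out : ∀ y, 1 - δ < ‖y‖ → Df y = e (ι y) := by
    intro y hy
    by_cases hy1 : ‖y‖ < 1
    · rw [hDf_in y hy1, hΘeq y hy.le hy1]
      exact hθ_right y (hshellO (mem_closedShell_iff.2 ⟨by linarith, hy1.le⟩))
    · exact if_neg hy1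
  -- Step H: smoothness
  have hDf_c : ContMDiff (𝓡 n) (𝓡 n) ∞ Df := by
    intro y
    by_cases hy : ‖y‖ < 1
    · have hmem : ball (0 : EuclideanSpace ℝ (Fin n)) 1 ∈ 𝓝 y :=
        isOpen_ball.mem_nhds (mem_ball_zero_iff.2 hy)
      have hev : Df =ᶠ[𝓝 y] (Dd ∘ Θ) :=
        Filter.eventuallyEq_of_mem hmem fun z hz ↦ hDf_in z (mem_ball_zero_iff.1 hz)
      exact ((hDd_c _).comp y (hΘ_md.contMDiffAt hmem)).congr_of_eventuallyEq hev
    · have hy' : 1 - δ < ‖y‖ := by linarith [not_lt.1 hy]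
      have hy0 : y ≠ 0 := by rw [← norm_pos_iff]; linarith [not_lt.1 hy]
      have hev : Df =ᶠ[𝓝 y] (e ∘ ι) :=
        Filter.eventuallyEq_of_mem ((isOpen_lt_norm δ).mem_nhds hy') fun z hz ↦ hDf_out z hz
      exact ((hec _).comp y (hι_md.contMDiffAt
        (isOpen_compl_singleton.mem_nhds hy0))).congr_of_eventuallyEq hev
  -- Step I: injectivity
  have hDf_in_mem : ∀ y, ‖y‖ < 1 →
      Df y ∈ (e '' closedBall (0 : EuclideanSpace ℝ (Fin n)) 1)ᶜ := fun y hy ↦ by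
    rw [hDf_in y hy, ← hDd_op]; exact ⟨Θ y, mem_ball_zero_iff.2 (hΘ_maps y hy), rfl⟩
  have hDf_out_mem : ∀ y, 1 ≤ ‖y‖ →
      Df y ∈ e '' closedBall (0 : EuclideanSpace ℝ (Fin n)) 1 := fun y hy ↦ by
    rw [hDf_out y (by linarith)]
    refine ⟨ι y, mem_closedBall_zero_iff.2 ?_, rfl⟩
    rw [hnormι]; exact inv_le_one_of_one_le₀ hy
  have hDf_inj : Injective Df := by
    intro y₁ y₂ h
    by_cases h1 : ‖y₁‖ < 1 <;> by_cases h2 : ‖y₂‖ < 1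
    · rw [hDf_in y₁ h1, hDf_in y₂ h2] at h
      have h' : Θ y₁ = Θ y₂ :=
        Dd.injOn (by rw [hDd_src]; trivial) (by rw [hDd_src]; trivial) h
      exact Θ.injOn (by rw [hΘs]; exact mem_ball_zero_iff.2 h1)
        (by rw [hΘs]; exact mem_ball_zero_iff.2 h2) h'
    · have hm := hDf_in_mem y₁ h1
      rw [h] at hm
      exact absurd (hDf_out_mem y₂ (not_lt.1 h2)) hm
    · have hm := hDf_in_mem y₂ h2
      rw [← h] at hm
      exact absurd (hDf_out_mem y₁ (not_lt.1 h1)) hm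
    · rw [hDf_out y₁ (by linarith [not_lt.1 h1]), hDf_out y₂ (by linarith [not_lt.1 h2])] at h
      have h' : ι y₁ = ι y₂ := heinj h
      have hy1 : y₁ ≠ 0 := by rw [← norm_pos_iff]; linarith [not_lt.1 h1]
      have hy2 : y₂ ≠ 0 := by rw [← norm_pos_iff]; linarith [not_lt.1 h2]
      rw [← sphereInversion.apply_apply y₁, ← sphereInversion.apply_apply y₂]
      exact congrArg sphereInversion h'
  -- Step J: `Df` is a local homeomorphism, hence an open embedding
  have hDf_loc : IsLocalHomeomorph Df := by
    refine IsLocalHomeomorph.mk Df fun y ↦ ?_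
    by_cases hy : ‖y‖ < 1
    · refine ⟨Θ.trans Dd, ?_, ?_⟩
      · rw [OpenPartialHomeomorph.trans_source, hΘs, hDd_src, preimage_univ, inter_univ]
        exact mem_ball_zero_iff.2 hy
      · intro z hz
        rw [OpenPartialHomeomorph.trans_source, hΘs, hDd_src, preimage_univ, inter_univ] at hz
        rw [hDf_in z (mem_ball_zero_iff.1 hz)]; rfl
    · refine ⟨(sphereInversion.partialHomeomorph.restrOpen {x | 1 - δ < ‖x‖}
        (isOpen_lt_norm δ)).trans e, ?_, ?_⟩
      · rw [OpenPartialHomeomorph.trans_source, OpenPartialHomeomorph.restrOpen_source, hsrc,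
          preimage_univ, inter_univ, sphereInversion.partialHomeomorph_source]
        exact ⟨by rw [mem_compl_singleton_iff, ← norm_pos_iff]; linarith [not_lt.1 hy],
          by show 1 - δ < ‖y‖; linarith [not_lt.1 hy]⟩
      · intro z hz
        rw [OpenPartialHomeomorph.trans_source, OpenPartialHomeomorph.restrOpen_source, hsrc,
          preimage_univ, inter_univ, sphereInversion.partialHomeomorph_source] at hz
        rw [hDf_out z hz.2]; rfl
  have hDf_open : IsOpenMap Df := hDf_loc.isOpenMap
  have hDf_emb : Topology.IsOpenEmbedding Df :=
    .of_continuous_injective_isOpenMap hDf_loc.continuous hDf_inj hDf_open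
  -- Step K: the partial homeomorphism and the smoothness of its inverse
  set D := hDf_emb.toOpenPartialHomeomorph Df with hD
  have hD_coe : (D : EuclideanSpace ℝ (Fin n) → sphere (0 : V) 1) = Df :=
    hDf_emb.toOpenPartialHomeomorph_apply Df
  have hD_src : D.source = univ := hDf_emb.toOpenPartialHomeomorph_source Df
  have hD_tgt : D.target = range Df := hDf_emb.toOpenPartialHomeomorph_target Df
  have hD_left : ∀ y, D.symm (Df y) = y := fun y ↦ hDf_emb.toOpenPartialHomeomorph_left_inv Df
  have hO₁_open : IsOpen (Dd '' ball (0 : EuclideanSpace ℝ (Fin n)) 1) := by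
    rw [hDd_op, isOpen_compl_iff]
    exact ((isCompact_closedBall _ _).image hec.continuous).isClosed
  have hsymm₁ : EqOn D.symm (Θ.symm ∘ Dd.symm) (Dd '' ball (0 : EuclideanSpace ℝ (Fin n)) 1) := by
    rintro _ ⟨z, hz, rfl⟩
    have hzt : z ∈ Θ.target := by rw [hΘt]; exact hz
    have hw : Θ.symm z ∈ ball (0 : EuclideanSpace ℝ (Fin n)) 1 := by
      have := Θ.map_target hzt; rwa [hΘs] at this
    have h1 : Df (Θ.symm z) = Dd z := by
      rw [hDf_in _ (mem_ball_zero_iff.1 hw), Θ.right_inv hzt]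
    show D.symm (Dd z) = Θ.symm (Dd.symm (Dd z))
    rw [Dd.left_inv (by rw [hDd_src]; trivial), ← h1, hD_left]
  have hc₁ : ContMDiffOn (𝓡 n) (𝓡 n) ∞ (Θ.symm ∘ Dd.symm)
      (Dd '' ball (0 : EuclideanSpace ℝ (Fin n)) 1) := by
    refine hΘ_md'.comp (hDd_c'.mono ?_) ?_
    · rintro _ ⟨z, -, rfl⟩
      rw [← hDd_tgt]; exact Dd.map_source (by rw [hDd_src]; trivial)
    · rintro _ ⟨z, hz, rfl⟩
      show Dd.symm (Dd z) ∈ ball (0 : EuclideanSpace ℝ (Fin n)) 1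
      rw [Dd.left_inv (by rw [hDd_src]; trivial)]; exact hz
  have hO₂_open : IsOpen (Df '' {x : EuclideanSpace ℝ (Fin n) | 1 - δ < ‖x‖}) :=
    hDf_open _ (isOpen_lt_norm δ)
  have hsymm₂ : EqOn D.symm (ι ∘ e.symm) (Df '' {x : EuclideanSpace ℝ (Fin n) | 1 - δ < ‖x‖}) := by
    rintro _ ⟨x, hx, rfl⟩
    have hx' : 1 - δ < ‖x‖ := hx
    have hx0 : x ≠ 0 := by rw [← norm_pos_iff]; linarith
    show D.symm (Df x) = ι (e.symm (Df x))
    rw [hD_left, hDf_out x hx', e.left_inv (by rw [hsrc]; trivial), hι,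
      sphereInversion.apply_apply]
  have hc₂ : ContMDiffOn (𝓡 n) (𝓡 n) ∞ (ι ∘ e.symm)
      (Df '' {x : EuclideanSpace ℝ (Fin n) | 1 - δ < ‖x‖}) := by
    refine hι_md.comp (he'.mono ?_) ?_
    · rintro _ ⟨x, hx, rfl⟩
      have hx' : 1 - δ < ‖x‖ := hx
      rw [hDf_out x hx']; exact e.map_source (by rw [hsrc]; trivial)
    · rintro _ ⟨x, hx, rfl⟩
      have hx' : 1 - δ < ‖x‖ := hx
      have hx0 : x ≠ 0 := by rw [← norm_pos_iff]; linarith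
      show e.symm (Df x) ≠ 0
      rw [hDf_out x hx', e.left_inv (by rw [hsrc]; trivial)]
      exact sphereInversion.ne_zero hx0
  have hD_c' : ContMDiffOn (𝓡 n) (𝓡 n) ∞ D.symm D.target := by
    rw [hD_tgt]
    rintro _ ⟨y, rfl⟩
    by_cases hy : ‖y‖ < 1
    · have hmem : Df y ∈ Dd '' ball (0 : EuclideanSpace ℝ (Fin n)) 1 := by
        rw [hDf_in y hy]; exact ⟨Θ y, mem_ball_zero_iff.2 (hΘ_maps y hy), rfl⟩
      exact ((hc₁.congr hsymm₁).contMDiffAt (hO₁_open.mem_nhds hmem)).contMDiffWithinAt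
    · have hmem : Df y ∈ Df '' {x : EuclideanSpace ℝ (Fin n) | 1 - δ < ‖x‖} :=
        ⟨y, by show 1 - δ < ‖y‖; linarith [not_lt.1 hy], rfl⟩
      exact ((hc₂.congr hsymm₂).contMDiffAt (hO₂_open.mem_nhds hmem)).contMDiffWithinAt
  -- Step L: the images of the unit balls
  have hΘ_img : Θ '' ball (0 : EuclideanSpace ℝ (Fin n)) 1 = ball 0 1 := by
    have := Θ.image_source_eq_target; rwa [hΘs, hΘt] at this
  have hD_ball : D '' ball 0 1 = (e '' closedBall 0 1)ᶜ := by
    have heq : EqOn Df (Dd ∘ Θ) (ball (0 : EuclideanSpace ℝ (Fin n)) 1) := fun z hz ↦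
      hDf_in z (mem_ball_zero_iff.1 hz)
    rw [hD_coe, heq.image_eq, image_comp, hΘ_img, hDd_op]
  have hD_closedBall : D '' closedBall 0 1 = (e '' ball 0 1)ᶜ := by
    rw [hD_coe]
    apply Subset.antisymm
    · rintro _ ⟨y, hy, rfl⟩ hmem
      rcases (mem_closedBall_zero_iff.1 hy).lt_or_eq with hy1 | hy1
      · exact hDf_in_mem y hy1 (image_mono ball_subset_closedBall hmem)
      · obtain ⟨w, hw, hwy⟩ := hmem
        rw [hDf_out y (by linarith), hι, sphereInversion.apply_of_norm_eq_one hy1] at hwy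
        have := heinj hwy
        subst this
        exact absurd (mem_ball_zero_iff.1 hw) hy1.symm.le.not_gt
    · intro p hp
      by_cases hp' : p ∈ e '' closedBall (0 : EuclideanSpace ℝ (Fin n)) 1
      · obtain ⟨w, hw, rfl⟩ := hp'
        have hw1 : ‖w‖ = 1 := by
          rcases (mem_closedBall_zero_iff.1 hw).lt_or_eq with h | h
          · exact absurd ⟨w, mem_ball_zero_iff.2 h, rfl⟩ hp
          · exact h
        refine ⟨w, hw, ?_⟩
        rw [hDf_out w (by linarith), hι, sphereInversion.apply_of_norm_eq_one hw1]
      · have : p ∈ (e '' closedBall (0 : EuclideanSpace ℝ (Fin n)) 1)ᶜ := hp'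
        rw [← hD_ball, hD_coe] at this
        exact image_mono ball_subset_closedBall this
  -- Step M: conclusion
  refine ⟨δ, D, hδ, hδ1, hD_src, ?_, hD_c', fun y hy ↦ ?_, hD_closedBall, hD_ball⟩
  · rw [hD_src, contMDiffOn_univ, hD_coe]; exact hDf_c
  · rw [hD_coe]; exact hDf_out y hy

end TwoSided

end Literature.Topology.FourManifolds

end
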